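import Mathlib

/-!
# Venture HSemireg — FORMULA-N residual box law: the linear-algebra core (th-7 g4)

HONEST FRAMING. Part of the Lean index of the computation cell `pub-hsemireg` (seat p3; Sunday enclosure of the
FORMULA-N kernel assets of seats th-7 / th-6, ENCLOSURE-PLAN-p3.md).  Finite-dimensional linear algebra (tensor products, rank–nullity) over a field ONLY:
no variety, no cohomology theory, no semiregularity map is constructed here; nothing here says that HC / HC_CM / HC_AV holds;
no Literature fact is declared or used.  The geometric DICTIONARY (why these ranks are the `HT`-side box ranks of the cell's
STRUCTURE.md §1 / theory/FORMULA-N.md) lives in theory/FORMULA-N-th7.md PART B §A.3 / §N and is NOT asserted in Lean.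

FORMULA-N PART B §C.4–§C.6 (th-7 g4): the LINEAR-ALGEBRA CORES of the residual box law (`residual_box`), of «residual
polynomials multiply» (`residual_poly_mul`, every degree) and of the gap identity / `res ≤ prim` (`gap_identity`, `res_le_prim`),
from right-exactness of `⊗` (`vis_eq_ker`, Mathlib `TensorProduct.map_ker`) and rank–nullity (`finrank_vis_add`,
`finrank_eq_map_add_inf_ker`).  th-7's statements and proofs VERBATIM (theory/th7/ResidualBox.lean v3 sha256/16 5fea34cf1aa07f3a,
124 l.; namespace `HSemiregResidualBox` ↦ `Summit.Ventures.HSemireg.FormulaN.ResidualBox`).  The sheaf-side inputs of §C.4–§C.6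
(Künneth for Ext of box products, multiplicativity of τ under ⊠, HH•-linearity) stay ON PAPER and are not asserted here; the
STRUCTURE.md C19 «box law» cell cites this kernel core only for the dimension count.

th-7 g4's header (verbatim, minus its scratch-asset framing sentence — this IS the tree copy): «# ResidualBox.lean v3 (th-7 g4 = literature-prover-pub-hsemireg-th-7-g4-0, 2026-08-22) — the linear-algebra core of
FORMULA-N PART B §C.4 «RESIDUAL BOX LAW» (STRUCTURE §1.1 row C19, box-law cell), kernel-checked.

PART B §C.4 (DERIVED on paper from Künneth for Ext of box products [GW2], multiplicativity of τ under ⊠ (KM) and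
HH•-linearity (H-B′) [BF08 §6.3]): for `E = F ⊠ F′`, `res₂(E) = res₂(F) + res₂(F′) + x₁(F)·x₁(F′)`. After the Künneth
bookkeeping (the degree-2 image `I₂(E) = I₂⊗I₀′ ⊕ I₁⊗I₁′ ⊕ I₀⊗I₂′` in three distinct bidegrees, `I₀ = I₀′ =` the line
of `ch`, and `N_Y·I₁(E)` with components `N_X·I₁ ⊗ I₀′`, `I₁ ⊗ N_{X′}·I₀′ + N_X·I₀ ⊗ I₁′`, `I₀ ⊗ N_{X′}·I₁′`), the ONE
step that is not bookkeeping is the dimension of the mixed block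

  `dim (A ⊗ B₀ + A₀ ⊗ B) = a·b₀ + a₀·b − a₀·b₀`   (`A₀ ≤ A`, `B₀ ≤ B` finite-dimensional; here `A = I₁(F) ⊇ A₀ = N_X·I₀`,
  `B = I₁(F′) ⊇ B₀ = N_{X′}·I₀′`),

proved below as `finrank_vis_add` from the right-exactness of `⊗` (Mathlib `TensorProduct.map_ker`:
`A ⊗ B₀ + A₀ ⊗ B = ker (A ⊗ B → A/A₀ ⊗ B/B₀)`) and rank–nullity; `residual_box` is §C.4 in its additive (subtraction-
free) bookkeeping form; `residual_poly_mul` (v2) is the EVERY-DEGREE form §C.5 «residual polynomials multiply»: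
`res_k(F ⊠ F′) = Σ_{i+j=k} res_i(F)·res_j(F′)`; `gap_identity` / `res_le_prim` (v3) are §C.6 (i): `prim − res =
dim ker τ − dim(ker τ ∩ A) ≥ 0`. MEASURED instance (PART B §C.4 (iii), ×3: th-6 floor code, t26sig 0.8.3 N = 6, t26sig 0.8.4
d2res): CORNER ⊠ CORNER ⊂ E⁶, `x₁ = x₁′ = 3`, residual `9 = 3·3`.»
-/

open Module
open scoped TensorProduct

namespace Summit.Ventures.HSemireg.FormulaN.ResidualBox

variable {K : Type*} [Field K] {A B : Type*} [AddCommGroup A] [Module K A] [AddCommGroup B] [Module K B]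

/-- the «visible» part of the mixed Künneth block: `A ⊗ B₀ + A₀ ⊗ B ⊆ A ⊗ B`. -/
noncomputable def vis (A₀ : Submodule K A) (B₀ : Submodule K B) : Submodule K (A ⊗[K] B) :=
  LinearMap.range (LinearMap.lTensor A B₀.subtype) ⊔ LinearMap.range (LinearMap.rTensor B A₀.subtype)

/-- right-exactness of `⊗`: `A ⊗ B₀ + A₀ ⊗ B = ker (A ⊗ B → (A/A₀) ⊗ (B/B₀))`. -/
theorem vis_eq_ker (A₀ : Submodule K A) (B₀ : Submodule K B) :
    vis A₀ B₀ = LinearMap.ker (TensorProduct.map A₀.mkQ B₀.mkQ) := by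
  rw [vis, TensorProduct.map_ker (hfg := LinearMap.exact_subtype_mkQ A₀) (hg := Submodule.mkQ_surjective A₀)
    (hfg' := LinearMap.exact_subtype_mkQ B₀) (hg' := Submodule.mkQ_surjective B₀)]

variable [FiniteDimensional K A] [FiniteDimensional K B]

/-- **`dim (A ⊗ B₀ + A₀ ⊗ B) + (a − a₀)(b − b₀) = a·b`**, i.e. `dim = a b₀ + a₀ b − a₀ b₀`. -/
theorem finrank_vis_add (A₀ : Submodule K A) (B₀ : Submodule K B) :
    finrank K (vis A₀ B₀) + (finrank K A - finrank K A₀) * (finrank K B - finrank K B₀) =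
      finrank K A * finrank K B := by
  have h1 := (LinearMap.ker (TensorProduct.map A₀.mkQ B₀.mkQ)).finrank_quotient_add_finrank
  rw [LinearEquiv.finrank_eq ((TensorProduct.map A₀.mkQ B₀.mkQ).quotKerEquivOfSurjective
      (TensorProduct.map_surjective (Submodule.mkQ_surjective A₀) (Submodule.mkQ_surjective B₀))),
    finrank_tensorProduct, finrank_tensorProduct, Submodule.finrank_quotient, Submodule.finrank_quotient,
    ← vis_eq_ker] at h1
  omega

/-- **§C.4 RESIDUAL BOX LAW, bookkeeping form.** Factor `F`: degree-1 image `I₁ ⊇ A₀ = N_X·I₀` (dims `ρ₁ ≥ r₁`,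
excess `x₁ = ρ₁ − r₁`), degree-2 image `I₂ ⊇ D = N_X·I₁` (dims `ρ₂ ≥ D₂`, residual `res₂ = ρ₂ − D₂`); factor `F′`
likewise (`J₁ ⊇ A₀′`, `J₂ ⊇ D′`). With `I₀ = I₀′ = K·ch` (dimension 1), Künneth gives `ρ₂(E) = ρ₂ + ρ₁ρ₁′ + ρ₂′` and
`D₂(E) = D₂ + dim(I₁ ⊗ A₀′ + A₀ ⊗ J₁) + D₂′`; the theorem says `D₂(E) + [res₂ + res₂′ + x₁x₁′] = ρ₂(E)`, i.e.
`res₂(E) = res₂(F) + res₂(F′) + x₁(F)·x₁(F′)`. -/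
theorem residual_box {I₁ I₂ J₁ J₂ : Type*} [AddCommGroup I₁] [Module K I₁] [AddCommGroup I₂] [Module K I₂]
    [AddCommGroup J₁] [Module K J₁] [AddCommGroup J₂] [Module K J₂] [FiniteDimensional K I₁]
    [FiniteDimensional K I₂] [FiniteDimensional K J₁] [FiniteDimensional K J₂]
    (A₀ : Submodule K I₁) (D : Submodule K I₂) (A₀' : Submodule K J₁) (D' : Submodule K J₂) :
    (finrank K D + finrank K (vis A₀ A₀') + finrank K D') +
        ((finrank K I₂ - finrank K D) + (finrank K J₂ - finrank K D') +
          (finrank K I₁ - finrank K A₀) * (finrank K J₁ - finrank K A₀')) =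
      finrank K I₂ + finrank K I₁ * finrank K J₁ + finrank K J₂ := by
  have h := finrank_vis_add A₀ A₀'
  have hD := Submodule.finrank_le D
  have hD' := Submodule.finrank_le D'
  omega

/-- the CORNER ⊠ CORNER instance of the excess term as pure arithmetic (PART B §C.4 (iii)): `ρ₁ = ρ₁′ = 9`, `r₁ = r₁′ = 6`
⇒ mixed visible block `9·6 + 6·9 − 6·6 = 72` of `81`, excess product `3·3 = 9`. -/
example : 9 * 6 + 6 * 9 - 6 * 6 + (9 - 6) * (9 - 6) = 9 * 9 := by decide

/-- **§C.5 RESIDUAL POLYNOMIALS MULTIPLY (every degree).** Factor `F`: images `I i` with floors `D i ≤ I i`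
(`D i = N_X·I (i-1)`, `D 0 = ⊥`), `res_i = dim I i − dim D i`; factor `F′` likewise (`I′`, `D′`). In bidegree `(i, j)` of
`E = F ⊠ F′` the floor is `vis (D i) (D′ j) = I i ⊗ D′ j + D i ⊗ I′ j`, so summing `finrank_vis_add` over `i + j = k` (`j = k − i`, `i ≤ k`):
`D_k(E) + Σ_{i+j=k} res_i · res′_j = ρ_k(E)` — i.e. `res_k(F ⊠ F′) = Σ_{i+j=k} res_i(F) res_j(F′)`, the residual
generating polynomials MULTIPLY (degree 2 = §C.4: `res₂ + x₁x₁′ + res₂′`). -/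
theorem residual_poly_mul {I I' : ℕ → Type*} [∀ i, AddCommGroup (I i)] [∀ i, Module K (I i)]
    [∀ i, FiniteDimensional K (I i)] [∀ j, AddCommGroup (I' j)] [∀ j, Module K (I' j)]
    [∀ j, FiniteDimensional K (I' j)] (D : ∀ i, Submodule K (I i)) (D' : ∀ j, Submodule K (I' j)) (k : ℕ) :
    ∑ i ∈ Finset.range (k + 1), finrank K (vis (D i) (D' (k - i))) +
        ∑ i ∈ Finset.range (k + 1),
          (finrank K (I i) - finrank K (D i)) * (finrank K (I' (k - i)) - finrank K (D' (k - i))) =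
      ∑ i ∈ Finset.range (k + 1), finrank K (I i) * finrank K (I' (k - i)) := by
  rw [← Finset.sum_add_distrib]
  exact Finset.sum_congr rfl fun i _ => finrank_vis_add (D i) (D' (k - i))

/-- rank–nullity for a restricted map: `dim U = dim g(U) + dim (U ∩ ker g)`. -/
theorem finrank_eq_map_add_inf_ker {V W : Type*} [AddCommGroup V] [Module K V] [FiniteDimensional K V]
    [AddCommGroup W] [Module K W] (U : Submodule K V) (g : V →ₗ[K] W) :
    finrank K U = finrank K (U.map g) + finrank K ↥(U ⊓ LinearMap.ker g) := by
  have h := LinearMap.finrank_range_add_finrank_ker (g.domRestrict U)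
  rw [LinearMap.range_domRestrict, LinearMap.ker_domRestrict, ← Submodule.finrank_map_subtype_eq U,
    Submodule.map_comap_subtype] at h
  exact h.symm

/-- **§C.6 (i) GAP IDENTITY, kernel form.** For `τ : E → H` (a degree-`k` component of the semiregularity map) and
`A ≤ E` (the classes generated from degree `k − 1`): with `e = dim E`, `h = dim A`, `ρ = rank τ`, `D = dim τ(A)`,
`prim = e − h`, `res = ρ − D`, one has `prim − res = dim ker τ − dim (ker τ ∩ A)`; stated additively:
`e + D + dim(ker τ ∩ A) = h + ρ + dim ker τ`. -/
theorem gap_identity {E H : Type*} [AddCommGroup E] [Module K E] [FiniteDimensional K E] [AddCommGroup H]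
    [Module K H] (τ : E →ₗ[K] H) (A : Submodule K E) :
    finrank K E + finrank K (A.map τ) + finrank K ↥(A ⊓ LinearMap.ker τ) =
      finrank K A + finrank K (LinearMap.range τ) + finrank K (LinearMap.ker τ) := by
  have h1 := LinearMap.finrank_range_add_finrank_ker τ
  have h2 := finrank_eq_map_add_inf_ker A τ
  omega

/-- hence `res ≤ prim`: `rank τ − dim τ(A) ≤ dim E − dim A` (additively). -/
theorem res_le_prim {E H : Type*} [AddCommGroup E] [Module K E] [FiniteDimensional K E] [AddCommGroup H]
    [Module K H] (τ : E →ₗ[K] H) (A : Submodule K E) :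
    finrank K (LinearMap.range τ) + finrank K A ≤ finrank K E + finrank K (A.map τ) := by
  have h := gap_identity τ A
  have h3 : finrank K ↥(A ⊓ LinearMap.ker τ) ≤ finrank K (LinearMap.ker τ) :=
    Submodule.finrank_mono inf_le_right
  omega

end Summit.Ventures.HSemireg.FormulaN.ResidualBox
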